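import Summits.QuantumFields.YangMills.Theorems.QuantileBitPuritySectorGoodDefs
import Summits.QuantumFields.YangMills.Theorems.QuantileBitPuritySectorGoodField
import HarnessLib

/-!
# The complement of the good-field event is negligible in every seam sector (union bound over slices, interior bonds and the seam bond)

Support module (`--supports` stmt-QuantumFields-23948; memo HOME `bc/g14-dw/PLAN-PERIODIC.md` §B.1).  For the good-field event `TT.goodEvent n z s t`
(defs module `QuantileBitPuritySectorGoodDefs`: slice actions `< s`, interior bonds and the SEAM bond `(U_n, g·tw_z U_0)` linkwise `t`-close) we prove

* §1 measurability; the pointwise union bound `𝟙_{goodᶜ} ≤ Σ_i 𝟙[s ≤ S(U_i)] + Σ_i 𝟙[bond i t-far] + 𝟙[seam t-far]`; finite additivity of `sectorWeight`;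
* §2 ★ `sectorWeight_indicator_compl_goodEvent_le_floor`: for `β ≥ max(9, 4/w₀)`, `n ≥ 1`, `t ≥ 0`, in EVERY sector `z`,
  `sectorWeight β n z 𝟙_{(goodEvent n z s t)ᶜ} ≤ (n+1) · (e^{−βs/2} + e^{−βt²/2}) · (β^N)^{n+1} · Z_phys(L, β, n+1)`, `N = 8|P| + 97|E|`
  (the cuts of `QuantileBitPuritySectorGoodField`).  With `βs/2 = βt²/2 = ((n+1)N + κ) log β` the right side is `2(n+1)β^{−κ} Z_phys`; and
  `Z_phys ≤ sectorWeight β n 0 1` (`TT.physTraceSucc_le_sectorWeight_untwisted`), so in the untwisted sector the bad fields carry a fraction `≤ 2(n+1)β^{−κ}`.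

So the stub `PeriodicCoreEstimate` may be proved on `goodEvent` only.  HONEST FRAMING: fixed-lattice bookkeeping; no semiclassics/RG; nothing about
infinite volume, the continuum limit or the Clay gap.  No `sorry`, no new axiom, no new definition.  References: [cite: Luscher1983, §2]; [cite: SeilerLNP1982, §3].
-/

set_option autoImplicit false

noncomputable section

open MeasureTheory Filter Topology Real Function
open scoped BigOperators
open Literature.MathematicalPhysics.QuantumLattice
open Literature.MathematicalPhysics.QuantumFieldTheory hiding SU2
open Summit.QuantumFields.YangMills.Theorems

namespace Summit.QuantumFields.YangMills.Theorems.FemtoTransferGap.TT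

open Summit.QuantumFields.YangMills.Theorems.FemtoTransferGap

variable {L : ℕ} [NeZero L]

/-! ## §1 Measurability, the pointwise union bound, finite additivity -/

/-- The good-field event is measurable (the link clauses are preimages of the complement of the tree's far event). [folklore] -/
theorem measurableSet_goodEvent (n : ℕ) (z : Fin 3 → Bool) (s t : ℝ) : MeasurableSet (goodEvent (L := L) n z s t) := by
  haveI : SecondCountableTopology SU2 := secondCountableTopology_su2
  set FAR : Set (GaugeConfig 3 L SU2 × GaugeConfig 3 L SU2) :=
    {q | ∃ e, t < frobNorm ((q.1 e : Matrix (Fin 2) (Fin 2) ℂ) - (q.2 e : Matrix (Fin 2) (Fin 2) ℂ))} with hFAR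
  have hFARm : MeasurableSet FAR := FlatSheet.measurableSet_far t
  have hS : Measurable fun U : GaugeConfig 3 L SU2 => wilsonAction su2Rep U := (continuous_wilsonAction su2Rep continuous_su2Rep).measurable
  have h1 : MeasurableSet {p : (Site 3 L → SU2) × (Fin (n + 1) → GaugeConfig 3 L SU2) | ∀ i : Fin (n + 1), wilsonAction su2Rep (p.2 i) < s} := by
    have : {p : (Site 3 L → SU2) × (Fin (n + 1) → GaugeConfig 3 L SU2) | ∀ i : Fin (n + 1), wilsonAction su2Rep (p.2 i) < s} =
        ⋂ i : Fin (n + 1), (fun p : (Site 3 L → SU2) × (Fin (n + 1) → GaugeConfig 3 L SU2) => wilsonAction su2Rep (p.2 i)) ⁻¹' Set.Iio s := by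
      ext p; simp
    rw [this]
    exact MeasurableSet.iInter fun i => (hS.comp ((measurable_pi_apply i).comp measurable_snd)) measurableSet_Iio
  have h2 : MeasurableSet (⋂ i : Fin n, (fun p : (Site 3 L → SU2) × (Fin (n + 1) → GaugeConfig 3 L SU2) => (p.2 i.castSucc, p.2 i.succ)) ⁻¹' FARᶜ) :=
    MeasurableSet.iInter fun i =>
      (((measurable_pi_apply i.castSucc).comp measurable_snd).prodMk ((measurable_pi_apply i.succ).comp measurable_snd)) hFARm.compl
  have hact : Measurable fun p : (Site 3 L → SU2) × (Fin (n + 1) → GaugeConfig 3 L SU2) => gaugeTransform p.1 (twist3 z (p.2 0)) := by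
    have h0 : Measurable fun p : (Site 3 L → SU2) × (Fin (n + 1) → GaugeConfig 3 L SU2) => (p.1, p.2 0) :=
      measurable_fst.prodMk ((measurable_pi_apply 0).comp measurable_snd)
    have h := (measurable_act_uncurry (L := L) z).comp h0
    exact h
  have h3 : MeasurableSet ((fun p : (Site 3 L → SU2) × (Fin (n + 1) → GaugeConfig 3 L SU2) => (p.2 (Fin.last n), gaugeTransform p.1 (twist3 z (p.2 0)))) ⁻¹' FARᶜ) :=
    (((measurable_pi_apply (Fin.last n)).comp measurable_snd).prodMk hact) hFARm.compl
  have heq : goodEvent (L := L) n z s t =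
      {p | ∀ i : Fin (n + 1), wilsonAction su2Rep (p.2 i) < s} ∩
      ((⋂ i : Fin n, (fun p : (Site 3 L → SU2) × (Fin (n + 1) → GaugeConfig 3 L SU2) => (p.2 i.castSucc, p.2 i.succ)) ⁻¹' FARᶜ) ∩
       ((fun p : (Site 3 L → SU2) × (Fin (n + 1) → GaugeConfig 3 L SU2) => (p.2 (Fin.last n), gaugeTransform p.1 (twist3 z (p.2 0)))) ⁻¹' FARᶜ)) := by
    ext p
    simp only [goodEvent, hFAR, Set.mem_setOf_eq, Set.mem_inter_iff, Set.mem_iInter, Set.mem_preimage, Set.mem_compl_iff, not_exists, not_lt]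
  rw [heq]
  exact h1.inter (h2.inter h3)

/-- **Pointwise union bound**: off the good-field event, some slice has action `≥ s`, or some interior bond or the seam bond has a `t`-far link.
[folklore] -/
theorem indicator_compl_goodEvent_le_sum (n : ℕ) (z : Fin 3 → Bool) (s t : ℝ) (Us : Fin (n + 1) → GaugeConfig 3 L SU2) (g : Site 3 L → SU2) :
    (goodEvent (L := L) n z s t)ᶜ.indicator (fun _ => (1 : ℝ)) (g, Us) ≤
      (∑ i : Fin (n + 1), Set.indicator {U : GaugeConfig 3 L SU2 | s ≤ wilsonAction su2Rep U} (fun _ => (1 : ℝ)) (Us i)) +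
      (∑ i : Fin n, Set.indicator {p : GaugeConfig 3 L SU2 × GaugeConfig 3 L SU2 |
          ∃ e, t < frobNorm ((p.1 e : Matrix (Fin 2) (Fin 2) ℂ) - (p.2 e : Matrix (Fin 2) (Fin 2) ℂ))} (fun _ => (1 : ℝ)) (Us i.castSucc, Us i.succ)) +
      Set.indicator {p : GaugeConfig 3 L SU2 × GaugeConfig 3 L SU2 |
          ∃ e, t < frobNorm ((p.1 e : Matrix (Fin 2) (Fin 2) ℂ) - (p.2 e : Matrix (Fin 2) (Fin 2) ℂ))} (fun _ => (1 : ℝ))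
        (Us (Fin.last n), gaugeTransform g (twist3 z (Us 0))) := by
  have hA0 : 0 ≤ ∑ i : Fin (n + 1), Set.indicator {U : GaugeConfig 3 L SU2 | s ≤ wilsonAction su2Rep U} (fun _ => (1 : ℝ)) (Us i) :=
    Finset.sum_nonneg fun i _ => Set.indicator_nonneg (fun _ _ => zero_le_one) _
  have hB0 : 0 ≤ ∑ i : Fin n, Set.indicator {p : GaugeConfig 3 L SU2 × GaugeConfig 3 L SU2 |
      ∃ e, t < frobNorm ((p.1 e : Matrix (Fin 2) (Fin 2) ℂ) - (p.2 e : Matrix (Fin 2) (Fin 2) ℂ))} (fun _ => (1 : ℝ)) (Us i.castSucc, Us i.succ) :=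
    Finset.sum_nonneg fun i _ => Set.indicator_nonneg (fun _ _ => zero_le_one) _
  have hC0 : 0 ≤ Set.indicator {p : GaugeConfig 3 L SU2 × GaugeConfig 3 L SU2 |
      ∃ e, t < frobNorm ((p.1 e : Matrix (Fin 2) (Fin 2) ℂ) - (p.2 e : Matrix (Fin 2) (Fin 2) ℂ))} (fun _ => (1 : ℝ))
        (Us (Fin.last n), gaugeTransform g (twist3 z (Us 0))) := Set.indicator_nonneg (fun _ _ => zero_le_one) _
  by_cases hg : (g, Us) ∈ goodEvent (L := L) n z s t
  · rw [Set.indicator_of_notMem (Set.notMem_compl_iff.2 hg)]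
    linarith
  · rw [Set.indicator_of_mem (Set.mem_compl hg)]
    -- one of the three clauses fails
    rw [mem_goodEvent_iff] at hg
    have hg' : (∃ i : Fin (n + 1), s ≤ wilsonAction su2Rep (Us i)) ∨
        (∃ (i : Fin n) (e : Edge 3 L), t < frobNorm ((Us i.castSucc e : Matrix (Fin 2) (Fin 2) ℂ) - (Us i.succ e : Matrix (Fin 2) (Fin 2) ℂ))) ∨
        (∃ e : Edge 3 L, t < frobNorm ((Us (Fin.last n) e : Matrix (Fin 2) (Fin 2) ℂ) -
          ((gaugeTransform g (twist3 z (Us 0))) e : Matrix (Fin 2) (Fin 2) ℂ))) := by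
      by_contra hcon
      simp only [not_or, not_exists, not_le, not_lt] at hcon
      exact hg ⟨hcon.1, hcon.2.1, hcon.2.2⟩
    rcases hg' with ⟨i, hi⟩ | ⟨i, e, he⟩ | ⟨e, he⟩
    · have h1 : (1 : ℝ) ≤ ∑ j : Fin (n + 1), Set.indicator {U : GaugeConfig 3 L SU2 | s ≤ wilsonAction su2Rep U} (fun _ => (1 : ℝ)) (Us j) := by
        have hmem : Us i ∈ {U : GaugeConfig 3 L SU2 | s ≤ wilsonAction su2Rep U} := hi
        calc (1 : ℝ) = Set.indicator {U : GaugeConfig 3 L SU2 | s ≤ wilsonAction su2Rep U} (fun _ => (1 : ℝ)) (Us i) := by rw [Set.indicator_of_mem hmem]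
          _ ≤ _ := Finset.single_le_sum (f := fun j => Set.indicator {U : GaugeConfig 3 L SU2 | s ≤ wilsonAction su2Rep U} (fun _ => (1 : ℝ)) (Us j))
              (fun j _ => Set.indicator_nonneg (fun _ _ => zero_le_one) _) (Finset.mem_univ i)
      linarith
    · have h1 : (1 : ℝ) ≤ ∑ j : Fin n, Set.indicator {p : GaugeConfig 3 L SU2 × GaugeConfig 3 L SU2 |
          ∃ e, t < frobNorm ((p.1 e : Matrix (Fin 2) (Fin 2) ℂ) - (p.2 e : Matrix (Fin 2) (Fin 2) ℂ))} (fun _ => (1 : ℝ)) (Us j.castSucc, Us j.succ) := by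
        have hmem : (Us i.castSucc, Us i.succ) ∈ {p : GaugeConfig 3 L SU2 × GaugeConfig 3 L SU2 |
            ∃ e, t < frobNorm ((p.1 e : Matrix (Fin 2) (Fin 2) ℂ) - (p.2 e : Matrix (Fin 2) (Fin 2) ℂ))} := ⟨e, he⟩
        calc (1 : ℝ) = Set.indicator {p : GaugeConfig 3 L SU2 × GaugeConfig 3 L SU2 |
              ∃ e, t < frobNorm ((p.1 e : Matrix (Fin 2) (Fin 2) ℂ) - (p.2 e : Matrix (Fin 2) (Fin 2) ℂ))} (fun _ => (1 : ℝ)) (Us i.castSucc, Us i.succ) := by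
                rw [Set.indicator_of_mem hmem]
          _ ≤ _ := Finset.single_le_sum (f := fun j : Fin n => Set.indicator {p : GaugeConfig 3 L SU2 × GaugeConfig 3 L SU2 |
                ∃ e, t < frobNorm ((p.1 e : Matrix (Fin 2) (Fin 2) ℂ) - (p.2 e : Matrix (Fin 2) (Fin 2) ℂ))} (fun _ => (1 : ℝ)) (Us j.castSucc, Us j.succ))
              (fun j _ => Set.indicator_nonneg (fun _ _ => zero_le_one) _) (Finset.mem_univ i)
      linarith
    · have hmem : (Us (Fin.last n), gaugeTransform g (twist3 z (Us 0))) ∈ {p : GaugeConfig 3 L SU2 × GaugeConfig 3 L SU2 |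
          ∃ e, t < frobNorm ((p.1 e : Matrix (Fin 2) (Fin 2) ℂ) - (p.2 e : Matrix (Fin 2) (Fin 2) ℂ))} := ⟨e, he⟩
      rw [Set.indicator_of_mem hmem]
      linarith

/-- **Finite additivity of the sector weight** over a finite family of bounded measurable functionals (`|F_i| ≤ 1`). [folklore] -/
theorem sectorWeight_finset_sum (β : ℝ) (n : ℕ) (z : Fin 3 → Bool) {ι : Type*} (S : Finset ι)
    (F : ι → (Fin (n + 1) → GaugeConfig 3 L SU2) → (Site 3 L → SU2) → ℝ) (hF : ∀ i, Measurable (uncurry (F i)))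
    (hFb : ∀ i Us g, |F i Us g| ≤ 1) :
    sectorWeight β n z (fun Us g => ∑ i ∈ S, F i Us g) = ∑ i ∈ S, sectorWeight β n z (F i) := by
  classical
  induction S using Finset.induction_on with
  | empty =>
    simp only [Finset.sum_empty]
    rw [sectorWeight_apply]; simp
  | insert a S ha ih =>
    have hfun : (fun (Us : Fin (n + 1) → GaugeConfig 3 L SU2) (g : Site 3 L → SU2) => ∑ i ∈ insert a S, F i Us g) =
        fun Us g => F a Us g + ∑ i ∈ S, F i Us g := by
      funext Us g; rw [Finset.sum_insert ha]
    rw [hfun, Finset.sum_insert ha, ← ih]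
    have hSm : Measurable (uncurry fun (Us : Fin (n + 1) → GaugeConfig 3 L SU2) (g : Site 3 L → SU2) => ∑ i ∈ S, F i Us g) := by
      have : (uncurry fun (Us : Fin (n + 1) → GaugeConfig 3 L SU2) (g : Site 3 L → SU2) => ∑ i ∈ S, F i Us g) =
          fun p => ∑ i ∈ S, uncurry (F i) p := by funext p; simp [uncurry]
      rw [this]; exact Finset.measurable_sum S fun i _ => hF i
    have hSb : ∀ (Us : Fin (n + 1) → GaugeConfig 3 L SU2) (g : Site 3 L → SU2), |∑ i ∈ S, F i Us g| ≤ S.card + 1 := fun Us g =>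
      (Finset.abs_sum_le_sum_abs _ _).trans ((Finset.sum_le_card_nsmul _ _ 1 fun i _ => hFb i Us g).trans (by simp))
    have hab : ∀ (Us : Fin (n + 1) → GaugeConfig 3 L SU2) (g : Site 3 L → SU2), |F a Us g| ≤ S.card + 1 := fun Us g =>
      (hFb a Us g).trans (by have : (0 : ℝ) ≤ S.card := Nat.cast_nonneg _; linarith)
    have h := sectorWeight_add (L := L) β n z (hF a) hSm hab hSb
    simpa only using h

/-! ## §2 The complement of the good-field event is negligible -/

/-- ★ **Bad fields are negligible in every sector**: for `β ≥ max(9, 4/w₀)`, `n ≥ 1`, `t ≥ 0` and every centre twist `z`,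
`sectorWeight β n z 𝟙_{(goodEvent n z s t)ᶜ} ≤ (n+1) · (e^{−βs/2} + e^{−βt²/2}) · (β^N)^{n+1} · Z_phys(L, β, n+1)`, `N = 8|P| + 97|E|`.
(Union bound over the `n+1` slices, the `n` interior bonds and the seam bond; cuts of `QuantileBitPuritySectorGoodField`.)  [cite: Luscher1983, §2] [cite: SeilerLNP1982, §3] -/
theorem sectorWeight_indicator_compl_goodEvent_le_floor {n : ℕ} (hn : 1 ≤ n) {β : ℝ} (hβ9 : 9 ≤ β)
    (hβw : 4 / (Real.exp (-(1 / 2 : ℝ)) * (8 / (3 * π ^ 3))) ≤ β) (z : Fin 3 → Bool) (s : ℝ) {t : ℝ} (ht : 0 ≤ t) :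
    sectorWeight β n z (fun Us g => (goodEvent (L := L) n z s t)ᶜ.indicator (fun _ => (1 : ℝ)) (g, Us)) ≤
      (n + 1) * (Real.exp (-(β / 2 * s)) + Real.exp (-(β * t ^ 2 / 2))) *
        (β ^ (8 * Fintype.card (Plaquette 3 L) + 97 * Fintype.card (Edge 3 L))) ^ (n + 1) * physTraceSucc L β n := by
  haveI : SecondCountableTopology SU2 := secondCountableTopology_su2
  set R : ℝ := (β ^ (8 * Fintype.card (Plaquette 3 L) + 97 * Fintype.card (Edge 3 L))) ^ (n + 1) * physTraceSucc L β n with hR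
  -- the three families of functionals
  set FA : Fin (n + 1) → (Fin (n + 1) → GaugeConfig 3 L SU2) → (Site 3 L → SU2) → ℝ :=
    fun i Us _ => Set.indicator {U : GaugeConfig 3 L SU2 | s ≤ wilsonAction su2Rep U} (fun _ => (1 : ℝ)) (Us i) with hFA
  set FB : Fin n → (Fin (n + 1) → GaugeConfig 3 L SU2) → (Site 3 L → SU2) → ℝ :=
    fun i Us _ => Set.indicator {p : GaugeConfig 3 L SU2 × GaugeConfig 3 L SU2 |
      ∃ e, t < frobNorm ((p.1 e : Matrix (Fin 2) (Fin 2) ℂ) - (p.2 e : Matrix (Fin 2) (Fin 2) ℂ))} (fun _ => (1 : ℝ)) (Us i.castSucc, Us i.succ) with hFB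
  set FC : (Fin (n + 1) → GaugeConfig 3 L SU2) → (Site 3 L → SU2) → ℝ :=
    fun Us g => Set.indicator {p : GaugeConfig 3 L SU2 × GaugeConfig 3 L SU2 |
      ∃ e, t < frobNorm ((p.1 e : Matrix (Fin 2) (Fin 2) ℂ) - (p.2 e : Matrix (Fin 2) (Fin 2) ℂ))} (fun _ => (1 : ℝ))
        (Us (Fin.last n), gaugeTransform g (twist3 z (Us 0))) with hFC
  have hAct : MeasurableSet {U : GaugeConfig 3 L SU2 | s ≤ wilsonAction su2Rep U} :=
    measurableSet_le measurable_const (continuous_wilsonAction su2Rep continuous_su2Rep).measurable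
  have hFAm : ∀ i, Measurable (uncurry (FA i)) := fun i =>
    (measurable_const.indicator hAct).comp ((measurable_pi_apply i).comp measurable_fst)
  have hFBm : ∀ i, Measurable (uncurry (FB i)) := fun i =>
    measurable_indicator_far_comp (L := L) (t := t) (((measurable_pi_apply i.castSucc).comp measurable_fst).prodMk ((measurable_pi_apply i.succ).comp measurable_fst))
  have hFCm : Measurable (uncurry FC) := by
    have h0 : Measurable fun p : (Fin (n + 1) → GaugeConfig 3 L SU2) × (Site 3 L → SU2) => (p.2, p.1 0) :=
      measurable_snd.prodMk ((measurable_pi_apply 0).comp measurable_fst)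
    have h1 := (measurable_act_uncurry (L := L) z).comp h0
    exact measurable_indicator_far_comp (L := L) (t := t) (((measurable_pi_apply (Fin.last n)).comp measurable_fst).prodMk h1)
  have hFAb : ∀ i Us g, |FA i Us g| ≤ 1 := fun i Us g => abs_indicator_one_le _ _
  have hFBb : ∀ i Us g, |FB i Us g| ≤ 1 := fun i Us g => abs_indicator_one_le _ _
  have hFCb : ∀ Us g, |FC Us g| ≤ 1 := fun Us g => abs_indicator_one_le _ _
  -- the dominating functional `G = Σ FA + Σ FB + FC`
  have hSAm : Measurable (uncurry fun (Us : Fin (n + 1) → GaugeConfig 3 L SU2) (g : Site 3 L → SU2) => ∑ i, FA i Us g) := by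
    have : (uncurry fun (Us : Fin (n + 1) → GaugeConfig 3 L SU2) (g : Site 3 L → SU2) => ∑ i, FA i Us g) = fun p => ∑ i, uncurry (FA i) p := by
      funext p; simp [uncurry]
    rw [this]; exact Finset.measurable_sum _ fun i _ => hFAm i
  have hSBm : Measurable (uncurry fun (Us : Fin (n + 1) → GaugeConfig 3 L SU2) (g : Site 3 L → SU2) => ∑ i, FB i Us g) := by
    have : (uncurry fun (Us : Fin (n + 1) → GaugeConfig 3 L SU2) (g : Site 3 L → SU2) => ∑ i, FB i Us g) = fun p => ∑ i, uncurry (FB i) p := by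
      funext p; simp [uncurry]
    rw [this]; exact Finset.measurable_sum _ fun i _ => hFBm i
  have hSAb : ∀ (Us : Fin (n + 1) → GaugeConfig 3 L SU2) (g : Site 3 L → SU2), |∑ i, FA i Us g| ≤ n + 1 := fun Us g =>
    (Finset.abs_sum_le_sum_abs _ _).trans ((Finset.sum_le_card_nsmul _ _ 1 fun i _ => hFAb i Us g).trans (by simp))
  have hSBb : ∀ (Us : Fin (n + 1) → GaugeConfig 3 L SU2) (g : Site 3 L → SU2), |∑ i, FB i Us g| ≤ n + 1 := fun Us g =>
    (Finset.abs_sum_le_sum_abs _ _).trans ((Finset.sum_le_card_nsmul _ _ 1 fun i _ => hFBb i Us g).trans (by simp))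
  have hABm : Measurable (uncurry fun (Us : Fin (n + 1) → GaugeConfig 3 L SU2) (g : Site 3 L → SU2) => ∑ i, FA i Us g + ∑ i, FB i Us g) := hSAm.add hSBm
  have hABb : ∀ (Us : Fin (n + 1) → GaugeConfig 3 L SU2) (g : Site 3 L → SU2), |∑ i, FA i Us g + ∑ i, FB i Us g| ≤ 2 * (n + 1) + 1 := fun Us g =>
    (abs_add_le _ _).trans (by have := hSAb Us g; have := hSBb Us g; linarith)
  have hGm : Measurable (uncurry fun (Us : Fin (n + 1) → GaugeConfig 3 L SU2) (g : Site 3 L → SU2) => (∑ i, FA i Us g + ∑ i, FB i Us g) + FC Us g) :=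
    hABm.add hFCm
  have hGb : ∀ (Us : Fin (n + 1) → GaugeConfig 3 L SU2) (g : Site 3 L → SU2), |(∑ i, FA i Us g + ∑ i, FB i Us g) + FC Us g| ≤ 2 * (n + 1) + 2 := fun Us g =>
    (abs_add_le _ _).trans (by have := hABb Us g; have := hFCb Us g; linarith)
  -- the bad indicator is dominated by `G`
  have hbadm : Measurable (uncurry fun (Us : Fin (n + 1) → GaugeConfig 3 L SU2) (g : Site 3 L → SU2) => (goodEvent n z s t)ᶜ.indicator (fun _ => (1 : ℝ)) (g, Us)) :=
    (measurable_const.indicator (measurableSet_goodEvent (L := L) n z s t).compl).comp (measurable_snd.prodMk measurable_fst)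
  have hbadb : ∀ (Us : Fin (n + 1) → GaugeConfig 3 L SU2) (g : Site 3 L → SU2), |(goodEvent n z s t)ᶜ.indicator (fun _ => (1 : ℝ)) (g, Us)| ≤ 2 * (n + 1) + 2 :=
    fun Us g => (abs_indicator_one_le _ _).trans (by have : (0 : ℝ) ≤ n := Nat.cast_nonneg _; linarith)
  have hmono := sectorWeight_mono (L := L) β n z hbadm hGm hbadb hGb fun Us g => indicator_compl_goodEvent_le_sum n z s t Us g
  -- split `sectorWeight G` into its `2n + 2` pieces
  have hsplit : sectorWeight β n z (fun Us g => (∑ i, FA i Us g + ∑ i, FB i Us g) + FC Us g) =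
      (∑ i, sectorWeight β n z (FA i)) + (∑ i, sectorWeight β n z (FB i)) + sectorWeight β n z FC := by
    have hC' : ∀ (Us : Fin (n + 1) → GaugeConfig 3 L SU2) (g : Site 3 L → SU2), |FC Us g| ≤ 2 * (n + 1) + 1 := fun Us g =>
      (hFCb Us g).trans (by have : (0 : ℝ) ≤ n := Nat.cast_nonneg _; linarith)
    rw [sectorWeight_add (L := L) β n z hABm hFCm hABb hC']
    have hA' : ∀ (Us : Fin (n + 1) → GaugeConfig 3 L SU2) (g : Site 3 L → SU2), |∑ i, FA i Us g| ≤ n + 1 := hSAb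
    rw [sectorWeight_add (L := L) β n z hSAm hSBm hA' hSBb, sectorWeight_finset_sum β n z Finset.univ FA hFAm hFAb,
      sectorWeight_finset_sum β n z Finset.univ FB hFBm hFBb]
  -- the three families of cuts
  have hA : ∀ i, sectorWeight β n z (FA i) ≤ Real.exp (-(β / 2 * s)) * R := fun i => by
    have h := sectorWeight_indicator_largeAction_le_floor (L := L) hn hβ9 hβw z s i
    rw [hR, ← mul_assoc]; exact h
  have hB : ∀ i, sectorWeight β n z (FB i) ≤ Real.exp (-(β * t ^ 2 / 2)) * R := fun i => by
    have h := sectorWeight_indicator_far_le_floor (L := L) hn hβ9 hβw ht z i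
    rw [hR, ← mul_assoc]; exact h
  have hC : sectorWeight β n z FC ≤ Real.exp (-(β * t ^ 2 / 2)) * R := by
    have h := sectorWeight_indicator_seamFar_le_floor (L := L) hn hβ9 hβw ht z
    rw [hR, ← mul_assoc]; exact h
  have hR0 : 0 ≤ R := by
    rw [hR]
    have hZ : 0 ≤ physTraceSucc L β n := by
      have h := floor_le_physTraceSucc (L := L) hn hβ9 hβw
      exact le_trans (by positivity) h
    have hβ0 : 0 ≤ β := by linarith
    positivity
  have hsumA : ∑ i : Fin (n + 1), sectorWeight β n z (FA i) ≤ (n + 1) * (Real.exp (-(β / 2 * s)) * R) :=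
    (Finset.sum_le_card_nsmul _ _ _ fun i _ => hA i).trans (by simp)
  have hsumB : ∑ i : Fin n, sectorWeight β n z (FB i) ≤ n * (Real.exp (-(β * t ^ 2 / 2)) * R) :=
    (Finset.sum_le_card_nsmul _ _ _ fun i _ => hB i).trans (by simp)
  have hexp0 : 0 ≤ Real.exp (-(β * t ^ 2 / 2)) * R := mul_nonneg (Real.exp_pos _).le hR0
  calc sectorWeight β n z (fun Us g => (goodEvent n z s t)ᶜ.indicator (fun _ => (1 : ℝ)) (g, Us))
      ≤ (∑ i, sectorWeight β n z (FA i)) + (∑ i, sectorWeight β n z (FB i)) + sectorWeight β n z FC := by rw [← hsplit]; exact hmono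
    _ ≤ (n + 1) * (Real.exp (-(β / 2 * s)) * R) + n * (Real.exp (-(β * t ^ 2 / 2)) * R) + Real.exp (-(β * t ^ 2 / 2)) * R :=
        add_le_add (add_le_add hsumA hsumB) hC
    _ = (n + 1) * (Real.exp (-(β / 2 * s)) + Real.exp (-(β * t ^ 2 / 2))) * R := by ring
    _ = _ := by rw [hR, ← mul_assoc]

end Summit.QuantumFields.YangMills.Theorems.FemtoTransferGap.TT

end
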